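import Mathlib
import HarnessLib
import Literature.MathematicalPhysics.QuantumLattice.TorusShellCountWindow
import Summits.HubbardSuperconductivity.HubbardSuperconductivity.Theorems.KLProgrammeKLRegimeFrameShellCount
import Summits.HubbardSuperconductivity.HubbardSuperconductivity.Theorems.KLProgrammeKLRegimeEnginePlaneWavePhases

/-!
# Route `KLProgramme` — ENGINE child gen 8 (stmt-HubbardSuperconductivity-20437 `KLRegimeEngineV17F2`), located item #19 «(c)-DRESSING-AVG» (plan g21 (R90)), input
# (W2)(A)+(B): the WINDOWED level count of the frame band on the torus grid, uniform over admissible frames (cell gate-hubbard-kl, seat hubbard-kl-p1 g13, EdgeFacts lane)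

WHY.  The class-#5 relative step (`pairTransferRelAt_succ_keyed`, p592121) inherits its bar through CONVOLUTIONS `Σ_c Bar(x,c)·|w_c|` of a gained profile
(`klRelGain n (|x − c|_𝕋)`, peak at transfer `Λₙ`) with weights `w` spread along the Fermi curve; hosting them needs the gain AVERAGED against the label
distribution of `w`, i.e. windowed sums `Σ_{c : |p_c − p_x|_𝕋 ≤ ρ} |w_c|`, whose counting input is the number of grid momenta in a thin frame shell AND a momentum
window.  p4's `card_frameLevel_lt_le` (`…FrameShellCount`) counts the whole shell (`≤ 1793ηL² + 704L`); this file is its WINDOW twin, from the Literature lemma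
`card_filter_abs_lt_window_le_of_geomConstants` (`TorusShellCountWindow`, p593668) at the engine's constants `Kc = 7`, `g₀ = 1/2`, `N = 352`:

* (A) dictionary `natAbs_valMinAbs_le_of_klTorusNorm_le`: `|q|_𝕋 ≤ ρ ⇒ |q̃_b| ≤ ⌊ρL/2π⌋` (centred representatives; `klTorusNorm_eq_max`, `…PlaneWavePhases`);
* (B) **`card_frameLevel_lt_labelWindow_le`**: `FrameOK R U N μ K → 0 ≤ η < 3/80 → #{k⃗ : |e_K(p_k⃗)| < η, |(k_j − x_j)~| ≤ w} ≤ (2w+1)·(1795·η·L + 704)`, every `L ≥ 1`,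
  centre `x`, half-width `w`; **`card_frameLevel_lt_torusWindow_le`**: the momentum-window form `#{k⃗ : |e_K(p_k⃗)| < η, |p_k⃗ − p_x⃗|_𝕋 ≤ ρ} ≤ (ρL/π + 1)·(1795·η·L + 704)`
  (`0 ≤ ρ`) — shape `C₁ηρL² + C₂ρL + C₃ηL + C₄`, uniform in the frame, `β`, `U`, `μ`, `n`.
(C) pointwise label bounds of the class-#5 weights and (D) the layer-cake against `klRelGain` follow in the EdgeFacts files.  Everything is proved; no definition;
nothing about the model is asserted.  0 kit · 0 lit.
-/

noncomputable section

namespace Summit.HubbardSuperconductivity.HubbardSuperconductivity.Theorems.KLRegimeSplit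

set_option linter.dupNamespace false -- summit = problem name (single-conjunct summit), D-0017

open Real Finset Literature.MathematicalPhysics.QuantumLattice Literature.Probability.LatticeModels
open Literature.MathematicalPhysics.QuantumLattice.FermiRG
open Summit.HubbardSuperconductivity.HubbardSuperconductivity.Theorems.DispersionFlow
open Summit.HubbardSuperconductivity.HubbardSuperconductivity.Theorems.KLProgrammeLegKernels

variable {L : ℕ} [NeZero L]

/-! ## (A) Torus norm ⇒ label window -/

/-- **A torus-norm ball is inside a label window**: `|p_q|_𝕋 ≤ ρ ⇒ |q̃_b| ≤ ⌊ρL/2π⌋` for each coordinate (`q̃` the centred representative). -/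
theorem natAbs_valMinAbs_le_of_klTorusNorm_le (q : TorusSite 2 L) {ρ : ℝ} (h : klTorusNorm L q ≤ ρ) (b : Fin 2) :
    ((q b).valMinAbs).natAbs ≤ ⌊ρ * L / (2 * π)⌋₊ := by
  have hL : (0 : ℝ) < L := Nat.cast_pos.2 (Nat.pos_of_ne_zero (NeZero.ne L))
  have hπ := Real.pi_pos
  have h1 : 2 * π * |((q b).valMinAbs : ℝ)| / L ≤ ρ := (EngineV8.two_pi_mul_abs_valMinAbs_div_le_klTorusNorm q b).trans h
  have h2 : |((q b).valMinAbs : ℝ)| ≤ ρ * L / (2 * π) := by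
    rw [le_div_iff₀ (by positivity)]
    rw [div_le_iff₀ hL] at h1
    linarith
  refine Nat.le_floor ?_
  have h3 : ((((q b).valMinAbs).natAbs : ℕ) : ℝ) = |((q b).valMinAbs : ℝ)| := by
    rw [Nat.cast_natAbs, Int.cast_abs]
  rw [h3]
  exact h2

omit [NeZero L] in
/-- The label-window half-width of a torus ball is at most `ρL/2π`: `(⌊ρL/2π⌋ : ℝ) ≤ ρL/2π` (`0 ≤ ρ`). -/
theorem floor_window_le {ρ : ℝ} (hρ : 0 ≤ ρ) : ((⌊ρ * L / (2 * π)⌋₊ : ℕ) : ℝ) ≤ ρ * L / (2 * π) :=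
  Nat.floor_le (by positivity)

/-! ## (B) The windowed level count of the frame band -/

omit [NeZero L] in
/-- The numerics: `2·352·(8η/(1/2))·(L/2π) + 2·352 ≤ 1795·η·L + 704` (`π > 3.1415`). -/
theorem frameWindowCount_numerics {η : ℝ} (hη : 0 ≤ η) (hL : (0 : ℝ) ≤ L) :
    2 * (((352 : ℕ) : ℝ) * (8 * η / (1 / 2) * ((L : ℝ) / (2 * π)) + 1)) ≤ 1795 * η * L + 704 := by
  have hπ := Real.pi_gt_d4
  have hπ0 : 0 < 2 * π := by positivity
  have h1 : 8 * η / (1 / 2) * ((L : ℝ) / (2 * π)) = 8 * η * L / π := by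
    field_simp
  rw [h1]
  have h2 : 8 * η * (L : ℝ) / π ≤ 2.549 * (η * L) := by
    rw [div_le_iff₀ (by positivity)]
    nlinarith [mul_nonneg hη hL]
  push_cast
  nlinarith [mul_nonneg hη hL]

/-- **Windowed level count of the frame band (label window)**: for every admissible frame (`FrameOK R U N μ K`; only clause (i) `GeomConstants (frameLevel μ K) 7 (3/80) (1/2) (3/200)`
is used), `0 ≤ η < 3/80`, centre `x` and half-width `w`:  `#{k⃗ : |e_K(p_k⃗)| < η, |(k_j − x_j)~| ≤ w (j = 0,1)} ≤ (2w+1)·(1795·η·L + 704)`, every `L ≥ 1`. -/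
theorem card_frameLevel_lt_labelWindow_le {R : RenConsts} {U : ℝ} {N : ℕ} {μ : ℝ} {K : TrigPolyC4v} (hK : FrameOK R U N μ K)
    {η : ℝ} (hη : 0 ≤ η) (hηr : η < 3 / 80) (x : TorusSite 2 L) (w : ℕ) :
    (((univ : Finset (TorusSite 2 L)).filter fun k =>
        |nambuXiCT L μ K k| < η ∧ ((k 0 - x 0).valMinAbs).natAbs ≤ w ∧ ((k 1 - x 1).valMinAbs).natAbs ≤ w).card : ℝ) ≤
      (2 * w + 1) * (1795 * η * L + 704) := by
  have hL : (0 : ℝ) ≤ L := Nat.cast_nonneg L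
  have main := card_filter_abs_lt_window_le_of_geomConstants (L := L) (frameLevel μ K) (EngineV8.contDiff_frameLevel μ K) hK.1
    (N := 352) (by norm_num) frameShellCount_N_ge hη hηr x w
  have hset : ((univ : Finset (TorusSite 2 L)).filter fun k =>
        |nambuXiCT L μ K k| < η ∧ ((k 0 - x 0).valMinAbs).natAbs ≤ w ∧ ((k 1 - x 1).valMinAbs).natAbs ≤ w) =
      (univ : Finset (TorusSite 2 L)).filter fun k =>
        |frameLevel μ K (WithLp.toLp 2 (latticeMomentum L k))| < η ∧
          ((k 0 - x 0).valMinAbs).natAbs ≤ w ∧ ((k 1 - x 1).valMinAbs).natAbs ≤ w := by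
    refine Finset.filter_congr fun k _ => ?_
    rw [EngineV8.nambuXiCT_eq_frameLevel]
  rw [hset]
  refine main.trans ?_
  have hnum := frameWindowCount_numerics hη hL
  have hw : (0 : ℝ) ≤ 2 * w + 1 := by positivity
  calc 2 * (2 * (w : ℝ) + 1) * ((352 : ℕ) * (8 * η / (1 / 2) * ((L : ℝ) / (2 * π)) + 1))
      = (2 * (w : ℝ) + 1) * (2 * (((352 : ℕ) : ℝ) * (8 * η / (1 / 2) * ((L : ℝ) / (2 * π)) + 1))) := by ring
    _ ≤ (2 * w + 1) * (1795 * η * L + 704) := mul_le_mul_of_nonneg_left hnum hw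

/-- **Windowed level count of the frame band (momentum window)**: `0 ≤ η < 3/80`, `0 ≤ ρ`, centre `x`:
`#{k⃗ : |e_K(p_k⃗)| < η, |p_{k⃗ − x⃗}|_𝕋 ≤ ρ} ≤ (ρL/π + 1)·(1795·η·L + 704)` — the shape `C₁ηρL² + C₂ρL + C₃ηL + C₄`, uniform in the frame. -/
theorem card_frameLevel_lt_torusWindow_le {R : RenConsts} {U : ℝ} {N : ℕ} {μ : ℝ} {K : TrigPolyC4v} (hK : FrameOK R U N μ K)
    {η : ℝ} (hη : 0 ≤ η) (hηr : η < 3 / 80) (x : TorusSite 2 L) {ρ : ℝ} (hρ : 0 ≤ ρ) :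
    (((univ : Finset (TorusSite 2 L)).filter fun k => |nambuXiCT L μ K k| < η ∧ klTorusNorm L (k - x) ≤ ρ).card : ℝ) ≤
      (ρ * L / π + 1) * (1795 * η * L + 704) := by
  have hL : (0 : ℝ) ≤ L := Nat.cast_nonneg L
  set w : ℕ := ⌊ρ * L / (2 * π)⌋₊ with hw
  -- the torus ball lies in the label window of half-width `w`
  have hsub : ((univ : Finset (TorusSite 2 L)).filter fun k => |nambuXiCT L μ K k| < η ∧ klTorusNorm L (k - x) ≤ ρ) ⊆
      (univ : Finset (TorusSite 2 L)).filter fun k =>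
        |nambuXiCT L μ K k| < η ∧ ((k 0 - x 0).valMinAbs).natAbs ≤ w ∧ ((k 1 - x 1).valMinAbs).natAbs ≤ w := by
    intro k hk
    rw [Finset.mem_filter] at hk ⊢
    refine ⟨hk.1, hk.2.1, ?_, ?_⟩
    · have := natAbs_valMinAbs_le_of_klTorusNorm_le (k - x) hk.2.2 0
      simpa only [Pi.sub_apply] using this
    · have := natAbs_valMinAbs_le_of_klTorusNorm_le (k - x) hk.2.2 1
      simpa only [Pi.sub_apply] using this
  have h1 := card_frameLevel_lt_labelWindow_le (L := L) hK hη hηr x w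
  have hwle : ((w : ℕ) : ℝ) ≤ ρ * L / (2 * π) := floor_window_le (L := L) hρ
  have hpos : 0 ≤ 1795 * η * (L : ℝ) + 704 := by positivity
  have hπ := Real.pi_pos
  calc (((univ : Finset (TorusSite 2 L)).filter fun k => |nambuXiCT L μ K k| < η ∧ klTorusNorm L (k - x) ≤ ρ).card : ℝ)
      ≤ (((univ : Finset (TorusSite 2 L)).filter fun k =>
          |nambuXiCT L μ K k| < η ∧ ((k 0 - x 0).valMinAbs).natAbs ≤ w ∧ ((k 1 - x 1).valMinAbs).natAbs ≤ w).card : ℝ) := by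
        exact_mod_cast Finset.card_le_card hsub
    _ ≤ (2 * w + 1) * (1795 * η * L + 704) := h1
    _ ≤ (ρ * L / π + 1) * (1795 * η * L + 704) := by
        refine mul_le_mul_of_nonneg_right ?_ hpos
        have : 2 * (ρ * L / (2 * π)) = ρ * L / π := by field_simp
        linarith

end Summit.HubbardSuperconductivity.HubbardSuperconductivity.Theorems.KLRegimeSplit

end
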